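import Mathlib
import Literature.Analysis.ODE.GalerkinLimit
import Summits.NavierStokesRegularity.FluidComputer.EmergenceMildDuhamel
import Summits.NavierStokesRegularity.FluidComputer.BoundedGeneratorDuhamel

/-!
# Galerkin → true passage of the emergence floor: slack bootstrap, linear consistency, closure under the `C⁰`-limit (instab g15, cell `ns-blowup`, 2026-08-26)

HONEST FRAMING (human ruling D-0035): nothing here is a claim about Navier–Stokes blow-up.
WHAT THIS IS NOT: not NS evidence. Item (γ) of `instab/INSTAB-BRIDGE.md` l.130 (d): the abstract
bookkeeping that carries the KEEP word (`EmergenceMildDuhamel.half_prediction_of_mild`) and the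
KILL word (`StabilityMildDuhamel.decay_two_of_mild`) from the GALERKIN truncations — where (M) and
(T) are theorems (`BoundedGeneratorDuhamel`, `BoundedGeneratorEmergence`, g14) — to the TRUE (limit)
trajectory of the tree's Wilczak–Zgliczyński `C⁰`-convergence engine
`Literature.Analysis.ODE.GalerkinConvergenceSetting` (`GalerkinLimit.lean`), with NO semigroup
theory for the unbounded linearised operator:

* SLACK. The level-`n` datum `P_n (ε v)` is NOT an eigenvector of the truncated generator `A_n`, so
  the level-`n` linear prediction `ℓ_n t = e^{tA_n} P_n (ε v)` has norm `ε e^{λt}` only up to a slack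
  `η_n`. `floor_of_mild_slack` / `half_prediction_of_mild_slack`: the bootstrap floor survives a
  slack `|‖ℓ t‖ − ε e^{λt}| ≤ η` if the Duhamel constant `C = S·c·√(π/(2λ − ω))` is replaced by any
  `C'` with `C·(Q a₀)² + η ≤ C'·(Q a₀)²` (`a₀ > 0` a lower bound of `ε e^{λt}` on the window; e.g.
  `C' = C + η/(Q a₀)²`, `duhamel_const_add_slack`).
* CONSISTENCY. `norm_linearFlow_sub_exp_smul_le`: for a bounded generator with the strong
  certificate bound `‖e^{sA} z‖ ≤ M_G e^{ω₁ s} ‖z‖` and ANY `y`, `μ`: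
  `‖e^{tA} y − e^{μt} y‖ ≤ M_G e^{(|ω₁|+|μ|)T₀} T₀ ‖A y − μ y‖` on `[0, T₀]` (variation of constants
  for `ψ s = e^{μs} y`); `linear_prediction_slack`: the slack of level `n` is driven by the residual
  `‖A_n P_n v − λ P_n v‖` on the ONE vector `v` and by `|‖P_n v‖ − 1|`.
* CLOSURE. `limit_norm_ge/le`: bounds `b n ≤ ‖u n x t‖` (`‖u n x t‖ ≤ b n`) for all large `n` with
  `b n → b₀` pass to any uniform limit; `solution_norm_ge/le`: by uniqueness within `W`
  (`limit_unique`) to EVERY classical solution of the full system from `x ∈ Z` staying in `W`;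
  `floor_of_galerkin_levels` / `half_of_floor` / `decay_of_galerkin_levels`: the KEEP and KILL shapes.

Sequel (inner-product bookkeeping with the level-`n` certificates): `GalerkinEmergenceTrue.lean`.
In print: linearised (in)stability via Galerkin approximation — folklore; the engine is
[WilczakZgliczynski2025, Thm. 11]. Mathlib + the three cited tree files; no new definitions.
-/

noncomputable section

namespace Summit.NavierStokesRegularity.FluidComputer.GalerkinEmergenceLimit

open Set Filter Topology MeasureTheory intervalIntegral NormedSpace
open Summit.NavierStokesRegularity.FluidComputer.EmergenceBootstrap
open Summit.NavierStokesRegularity.FluidComputer.EmergenceMildDuhamel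
open Summit.NavierStokesRegularity.FluidComputer.BoundedGeneratorDuhamel
open Literature.Analysis.ODE

variable {E : Type*} [NormedAddCommGroup E] [NormedSpace ℝ E]

/-! ### Slack absorption -/

/-- **Absorbing an additive slack into the quadratic deviation.** If `|f − a| ≤ C (Q a)² + η` with
`0 < a₀ ≤ a`, `0 < Q`, `0 ≤ η`, and `C'` satisfies `C (Q a₀)² + η ≤ C' (Q a₀)²`, then
`|f − a| ≤ C' (Q a)²`. -/
theorem abs_sub_le_of_slack {f a C Q η a₀ C' : ℝ} (hQ : 0 < Q) (hη : 0 ≤ η) (ha₀ : 0 < a₀) (ha : a₀ ≤ a) (h : |f - a| ≤ C * (Q * a) ^ 2 + η)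
    (hC' : C * (Q * a₀) ^ 2 + η ≤ C' * (Q * a₀) ^ 2) :
    |f - a| ≤ C' * (Q * a) ^ 2 := by
  have hQa₀ : 0 < (Q * a₀) ^ 2 := by positivity
  have hCC : C ≤ C' := by
    have h1 : C * (Q * a₀) ^ 2 ≤ C' * (Q * a₀) ^ 2 := by linarith
    exact le_of_mul_le_mul_right h1 hQa₀
  have ha' : 0 ≤ a := ha₀.le.trans ha
  have hmono : (Q * a₀) ^ 2 ≤ (Q * a) ^ 2 := by gcongr
  have h1 : η ≤ (C' - C) * (Q * a₀) ^ 2 := by linarith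
  have h2 : (C' - C) * (Q * a₀) ^ 2 ≤ (C' - C) * (Q * a) ^ 2 :=
    mul_le_mul_of_nonneg_left hmono (sub_nonneg.2 hCC)
  calc |f - a| ≤ C * (Q * a) ^ 2 + η := h
    _ ≤ C * (Q * a) ^ 2 + (C' - C) * (Q * a) ^ 2 := by linarith
    _ = C' * (Q * a) ^ 2 := by ring

/-- The explicit constant `C' = C + η/(Q a₀)²` satisfies the absorption condition of
`abs_sub_le_of_slack` (with equality). -/
theorem duhamel_const_add_slack {C Q η a₀ : ℝ} (hQ : Q ≠ 0) (ha₀ : a₀ ≠ 0) :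
    C * (Q * a₀) ^ 2 + η ≤ (C + η / (Q * a₀) ^ 2) * (Q * a₀) ^ 2 := by
  have h : (Q * a₀) ^ 2 ≠ 0 := pow_ne_zero 2 (mul_ne_zero hQ ha₀)
  rw [add_mul, div_mul_cancel₀ η h]

/-! ### The bootstrap floor with a slack in the linear prediction -/

/-- **R-β with slack (the level-`n` form of `EmergenceMildDuhamel.floor_of_mild`).** Let `T, B, p`
satisfy (T) `‖T τ x‖ ≤ S τ^{−1/2} e^{ωτ} p x` and (B) `p (B x y) ≤ c ‖x‖ ‖y‖` with `S, c ≥ 0`,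
`2λ > ω`; let `u` be continuous on `[0, T₀]` and satisfy the mild formula (M) about a linear part
`ℓ` whose norm is the prediction `ε e^{λt}` UP TO A SLACK, `|‖ℓ t‖ − ε e^{λt}| ≤ η`; let
`0 < a₀ ≤ ε e^{λt}` on the window, `Q ≥ 1`, and let `C'` absorb the slack:
`C (Q a₀)² + η ≤ C' (Q a₀)²` with `C = S·c·√(π/(2λ − ω))`. If the window condition
`C' Q² ε e^{λt} < Q − 1` holds on `[0, T₀]`, then on all of `[0, T₀]`:
`ε e^{λt} (1 − C' Q² ε e^{λt}) ≤ ‖u t‖ ≤ ε e^{λt} + C' (Q ε e^{λt})²`. -/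
theorem floor_of_mild_slack {p : E → ℝ} {T : ℝ → E → E} {B : E → E → E} {u ℓ : ℝ → E}
    {S c Q ε lam ω T₀ η a₀ C' : ℝ} (hS : 0 ≤ S) (hc : 0 ≤ c) (hgap : ω < 2 * lam) (hε : 0 < ε)
    (hQ : 1 ≤ Q) (ha₀ : 0 < a₀)
    (hT : ∀ τ : ℝ, 0 < τ → ∀ x : E, ‖T τ x‖ ≤ S * τ ^ (-(1 / 2 : ℝ)) * Real.exp (ω * τ) * p x)
    (hB : ∀ x y : E, p (B x y) ≤ c * ‖x‖ * ‖y‖)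
    (hu : ContinuousOn u (Icc 0 T₀))
    (hmild : ∀ t ∈ Icc 0 T₀, u t - ℓ t = ∫ s in (0:ℝ)..t, T (t - s) (B (u s) (u s)))
    (hℓ : ∀ t ∈ Icc 0 T₀, |‖ℓ t‖ - ε * Real.exp (lam * t)| ≤ η)
    (ha : ∀ t ∈ Icc 0 T₀, a₀ ≤ ε * Real.exp (lam * t))
    (hC' : S * c * Real.sqrt (Real.pi / (2 * lam - ω)) * (Q * a₀) ^ 2 + η ≤ C' * (Q * a₀) ^ 2)
    (hsmall : ∀ t ∈ Icc 0 T₀, C' * Q ^ 2 * (ε * Real.exp (lam * t)) < Q - 1) :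
    ∀ t ∈ Icc 0 T₀,
      ε * Real.exp (lam * t) * (1 - C' * Q ^ 2 * (ε * Real.exp (lam * t))) ≤ ‖u t‖
      ∧ ‖u t‖ ≤ ε * Real.exp (lam * t) + C' * (Q * (ε * Real.exp (lam * t))) ^ 2 := by
  set C : ℝ := S * c * Real.sqrt (Real.pi / (2 * lam - ω)) with hC
  intro t ht
  have hT₀ : 0 ≤ T₀ := ht.1.trans ht.2
  have hQ0 : 0 < Q := by linarith
  have hCnn : 0 ≤ C := by positivity
  have hQa₀ : 0 < (Q * a₀) ^ 2 := by positivity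
  have hη : 0 ≤ η := (abs_nonneg _).trans (hℓ t ht)
  have hCC : C ≤ C' := le_of_mul_le_mul_right (by linarith [hC']) hQa₀
  have hC'0 : 0 ≤ C' := hCnn.trans hCC
  -- the data of `floor_of_bootstrap` with f = ‖u ·‖, a = ε e^{λ·}, constant C'
  have hf : ContinuousOn (fun t => ‖u t‖) (Icc 0 T₀) := continuous_norm.comp_continuousOn hu
  have ha' : ContinuousOn (fun t => ε * Real.exp (lam * t)) (Icc 0 T₀) :=
    (by fun_prop : Continuous fun t => ε * Real.exp (lam * t)).continuousOn
  have h0 : ‖u 0‖ ≤ Q * (ε * Real.exp (lam * 0)) := by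
    have h0I : (0:ℝ) ∈ Icc 0 T₀ := ⟨le_rfl, hT₀⟩
    have hm := hmild 0 h0I
    rw [intervalIntegral.integral_same, sub_eq_zero] at hm
    rw [hm]
    set A0 : ℝ := ε * Real.exp (lam * 0) with hA0
    have h1 : ‖ℓ 0‖ ≤ A0 + η := by
      have := (le_abs_self (‖ℓ 0‖ - A0)).trans (hℓ 0 h0I)
      linarith
    have h2 : a₀ ≤ A0 := ha 0 h0I
    have h3 : C' * Q ^ 2 * A0 < Q - 1 := hsmall 0 h0I
    have s1 : η ≤ C' * (Q * a₀) ^ 2 := by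
      have : 0 ≤ C * (Q * a₀) ^ 2 := by positivity
      linarith
    have s2 : C' * (Q * a₀) ^ 2 ≤ C' * Q ^ 2 * A0 * a₀ := by
      have e1 : C' * (Q * a₀) ^ 2 = C' * Q ^ 2 * a₀ * a₀ := by ring
      rw [e1]
      have : C' * Q ^ 2 * a₀ ≤ C' * Q ^ 2 * A0 :=
        mul_le_mul_of_nonneg_left h2 (by positivity)
      exact mul_le_mul_of_nonneg_right this ha₀.le
    have s3 : C' * Q ^ 2 * A0 * a₀ < (Q - 1) * a₀ := mul_lt_mul_of_pos_right h3 ha₀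
    have s4 : (Q - 1) * a₀ ≤ (Q - 1) * A0 := mul_le_mul_of_nonneg_left h2 (by linarith)
    nlinarith
  have hdev : ∀ t ∈ Icc 0 T₀, (∀ s ∈ Icc 0 t, ‖u s‖ ≤ Q * (ε * Real.exp (lam * s))) →
      |‖u t‖ - ε * Real.exp (lam * t)| ≤ C' * (Q * (ε * Real.exp (lam * t))) ^ 2 := by
    intro t ht hap
    have hap' : ∀ s ∈ Icc 0 t, ‖u s‖ ≤ Q * ε * Real.exp (lam * s) := fun s hs => by
      rw [mul_assoc]; exact hap s hs
    have hd := norm_sub_le_of_mild hS hc hgap ht.1 hT hB (hmild t ht) hap'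
    have e : (Q * ε * Real.exp (lam * t)) ^ 2 = (Q * (ε * Real.exp (lam * t))) ^ 2 := by ring
    rw [e] at hd
    have htri : |‖u t‖ - ε * Real.exp (lam * t)|
        ≤ C * (Q * (ε * Real.exp (lam * t))) ^ 2 + η :=
      calc |‖u t‖ - ε * Real.exp (lam * t)|
          ≤ |‖u t‖ - ‖ℓ t‖| + |‖ℓ t‖ - ε * Real.exp (lam * t)| := abs_sub_le _ _ _
        _ ≤ ‖u t - ℓ t‖ + η := add_le_add (abs_norm_sub_norm_le _ _) (hℓ t ht)
        _ ≤ C * (Q * (ε * Real.exp (lam * t))) ^ 2 + η := by rw [hC]; linarith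
    exact abs_sub_le_of_slack hQ0 hη ha₀ (ha t ht) htri hC'
  have hsmall' : ∀ t ∈ Icc 0 T₀, 0 < ε * Real.exp (lam * t) ∧
      C' * Q ^ 2 * (ε * Real.exp (lam * t)) < Q - 1 := fun t ht =>
    ⟨by positivity, hsmall t ht⟩
  exact floor_of_bootstrap (f := fun t => ‖u t‖) (a := fun t => ε * Real.exp (lam * t))
    (T := T₀) (Q := Q) (C := C') hf ha' h0 hdev hsmall' t ht

/-- **From a floor to the half prediction (pure arithmetic, Q = 3/2).** If `0 < a`,
`a (1 − C (3/2)² a) ≤ f` and `a ≤ 2/(9 C)`, then `a / 2 ≤ f`. (For `C ≤ 0` the threshold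
`2/(9C) ≤ 0` cannot bound a positive `a`, so that case is vacuous.) -/
theorem half_of_floor {f a C : ℝ} (ha : 0 < a) (hfloor : a * (1 - C * (3 / 2 : ℝ) ^ 2 * a) ≤ f)
    (hχ : a ≤ 2 / (9 * C)) : a / 2 ≤ f := by
  rcases le_or_gt C 0 with hC | hC
  · exfalso
    have : 2 / (9 * C) ≤ 0 := div_nonpos_of_nonneg_of_nonpos (by norm_num) (by linarith)
    linarith
  · have hkey : C * (3 / 2 : ℝ) ^ 2 * a ≤ 1 / 2 := by
      have : C * (3 / 2 : ℝ) ^ 2 * a ≤ C * (3 / 2 : ℝ) ^ 2 * (2 / (9 * C)) :=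
        mul_le_mul_of_nonneg_left hχ (by positivity)
      have e : C * (3 / 2 : ℝ) ^ 2 * (2 / (9 * C)) = 1 / 2 := by field_simp; ring
      linarith
    nlinarith

/-- **The amplitude floor and the clock with slack (Q = 3/2).** In the setting of
`floor_of_mild_slack` with `Q = 3/2`: at every `t ∈ [0, T₀]` with `ε e^{λt} ≤ 2/(9 C')`,
`‖u t‖ ≥ ε e^{λt}/2`. -/
theorem half_prediction_of_mild_slack {p : E → ℝ} {T : ℝ → E → E} {B : E → E → E}
    {u ℓ : ℝ → E} {S c ε lam ω T₀ η a₀ C' : ℝ} (hS : 0 ≤ S) (hc : 0 ≤ c) (hgap : ω < 2 * lam)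
    (hε : 0 < ε) (ha₀ : 0 < a₀)
    (hT : ∀ τ : ℝ, 0 < τ → ∀ x : E, ‖T τ x‖ ≤ S * τ ^ (-(1 / 2 : ℝ)) * Real.exp (ω * τ) * p x)
    (hB : ∀ x y : E, p (B x y) ≤ c * ‖x‖ * ‖y‖)
    (hu : ContinuousOn u (Icc 0 T₀))
    (hmild : ∀ t ∈ Icc 0 T₀, u t - ℓ t = ∫ s in (0:ℝ)..t, T (t - s) (B (u s) (u s)))
    (hℓ : ∀ t ∈ Icc 0 T₀, |‖ℓ t‖ - ε * Real.exp (lam * t)| ≤ η)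
    (ha : ∀ t ∈ Icc 0 T₀, a₀ ≤ ε * Real.exp (lam * t))
    (hC' : S * c * Real.sqrt (Real.pi / (2 * lam - ω)) * ((3 / 2 : ℝ) * a₀) ^ 2 + η ≤
      C' * ((3 / 2 : ℝ) * a₀) ^ 2)
    (hsmall : ∀ t ∈ Icc 0 T₀, C' * (3 / 2 : ℝ) ^ 2 * (ε * Real.exp (lam * t)) < 3 / 2 - 1)
    {t : ℝ} (ht : t ∈ Icc 0 T₀) (hχ : ε * Real.exp (lam * t) ≤ 2 / (9 * C')) :
    ε * Real.exp (lam * t) / 2 ≤ ‖u t‖ := by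
  have h := (floor_of_mild_slack hS hc hgap hε (by norm_num : (1:ℝ) ≤ 3 / 2) ha₀ hT hB hu hmild
    hℓ ha hC' hsmall t ht).1
  exact half_of_floor (by positivity) h hχ

/-! ### Consistency of the linear flow on an approximate eigenvector -/

section Consistency

variable [CompleteSpace E]

/-- **Linear consistency (variation of constants on `ψ s = e^{μs} y`).** Let `A : E →L[ℝ] E` have a
linear flow dominated by the strong certificate, `‖e^{sA} z‖ ≤ M_G e^{ω₁ s} ‖z‖` for `s ≥ 0`
(`M_G ≥ 0`). Then for every vector `y`, rate `μ` and `t ∈ [0, T₀]`: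
`‖e^{tA} y − e^{μt} y‖ ≤ M_G · e^{(|ω₁| + |μ|) T₀} · T₀ · ‖A y − μ y‖` — the linear flow follows the
exponential `e^{μt} y` up to an error driven by the eigen-residual `A y − μ y`. -/
theorem norm_linearFlow_sub_exp_smul_le (A : E →L[ℝ] E) {MG ω₁ : ℝ} (hMG : 0 ≤ MG)
    (hflow : ∀ s : ℝ, 0 ≤ s → ∀ z : E, ‖exp (s • A) z‖ ≤ MG * Real.exp (ω₁ * s) * ‖z‖)
    (y : E) (μ : ℝ) {t T₀ : ℝ} (ht : t ∈ Icc 0 T₀) :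
    ‖exp (t • A) y - Real.exp (μ * t) • y‖
      ≤ MG * Real.exp ((|ω₁| + |μ|) * T₀) * T₀ * ‖A y - μ • y‖ := by
  set ψ : ℝ → E := fun s => Real.exp (μ * s) • y with hψ
  set G : ℝ → E := fun s => Real.exp (μ * s) • (μ • y - A y) with hG
  have hψder : ∀ s : ℝ, HasDerivAt ψ (A (ψ s) + G s) s := by
    intro s
    have h1 : HasDerivAt (fun s : ℝ => Real.exp (μ * s)) (Real.exp (μ * s) * μ) s := by
      have h := ((hasDerivAt_id s).const_mul μ).exp
      simpa using h
    have h2 := h1.smul_const y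
    refine h2.congr_deriv ?_
    simp only [hψ, hG, map_smul, smul_sub, smul_smul]
    abel
  have hψcont : Continuous ψ := continuous_iff_continuousAt.2 fun s => (hψder s).continuousAt
  have hGcont : Continuous G := by
    have : Continuous fun s : ℝ => Real.exp (μ * s) := by fun_prop
    exact this.smul continuous_const
  have hVC := variation_of_constants A (u := ψ) (F := G) ht.1 hψcont.continuousOn
    hGcont.continuousOn (fun s _ => hψder s)
  have hψ0 : ψ 0 = y := by simp [hψ]
  rw [hψ0] at hVC
  have heq : exp (t • A) y - Real.exp (μ * t) • y
      = -(∫ s in (0:ℝ)..t, exp ((t - s) • A) (G s)) := by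
    rw [show Real.exp (μ * t) • y = ψ t from rfl, hVC]; abel
  rw [heq, norm_neg]
  set K : ℝ := MG * Real.exp ((|ω₁| + |μ|) * T₀) * ‖A y - μ • y‖ with hK
  have hbound : ∀ s ∈ Set.uIoc (0:ℝ) t, ‖exp ((t - s) • A) (G s)‖ ≤ K := by
    intro s hs
    rw [Set.uIoc_of_le ht.1] at hs
    have hts : 0 ≤ t - s := by linarith [hs.2]
    have h1 := hflow (t - s) hts (G s)
    have hGs : ‖G s‖ = Real.exp (μ * s) * ‖A y - μ • y‖ := by
      show ‖Real.exp (μ * s) • (μ • y - A y)‖ = _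
      rw [norm_smul, Real.norm_of_nonneg (Real.exp_pos _).le, norm_sub_rev]
    have hexp : Real.exp (ω₁ * (t - s)) * Real.exp (μ * s) ≤ Real.exp ((|ω₁| + |μ|) * T₀) := by
      rw [← Real.exp_add]
      apply Real.exp_le_exp.2
      have e1 : ω₁ * (t - s) ≤ |ω₁| * T₀ :=
        calc ω₁ * (t - s) ≤ |ω₁| * (t - s) := mul_le_mul_of_nonneg_right (le_abs_self _) hts
          _ ≤ |ω₁| * T₀ := mul_le_mul_of_nonneg_left (by linarith [hs.1, ht.2]) (abs_nonneg _)
      have e2 : μ * s ≤ |μ| * T₀ :=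
        calc μ * s ≤ |μ| * s := mul_le_mul_of_nonneg_right (le_abs_self _) hs.1.le
          _ ≤ |μ| * T₀ := mul_le_mul_of_nonneg_left (by linarith [hs.2, ht.2]) (abs_nonneg _)
      linarith
    calc ‖exp ((t - s) • A) (G s)‖ ≤ MG * Real.exp (ω₁ * (t - s)) * ‖G s‖ := h1
      _ = MG * (Real.exp (ω₁ * (t - s)) * Real.exp (μ * s)) * ‖A y - μ • y‖ := by
          rw [hGs]; ring
      _ ≤ MG * Real.exp ((|ω₁| + |μ|) * T₀) * ‖A y - μ • y‖ :=
          mul_le_mul_of_nonneg_right (mul_le_mul_of_nonneg_left hexp hMG) (norm_nonneg _)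
  have hint := intervalIntegral.norm_integral_le_of_norm_le_const hbound
  rw [sub_zero, abs_of_nonneg ht.1] at hint
  have hKnn : 0 ≤ K := by positivity
  calc ‖∫ s in (0:ℝ)..t, exp ((t - s) • A) (G s)‖ ≤ K * t := hint
    _ ≤ K * T₀ := mul_le_mul_of_nonneg_left ht.2 hKnn
    _ = MG * Real.exp ((|ω₁| + |μ|) * T₀) * T₀ * ‖A y - μ • y‖ := by rw [hK]; ring

/-- **The slack of the level-`n` linear prediction.** Under the strong certificate bound of
`norm_linearFlow_sub_exp_smul_le`, for every `y` (think `y = P_n v`), `ε ≥ 0` and `t ∈ [0, T₀]`: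
`|‖e^{tA}(ε y)‖ − ε e^{λt}| ≤ ε · (M_G e^{(|ω₁|+|λ|)T₀} T₀ ‖A y − λ y‖ + e^{|λ| T₀} |‖y‖ − 1|)` —
hypothesis `hℓ` of `floor_of_mild_slack` for `ℓ t = e^{tA}(ε y)`. -/
theorem linear_prediction_slack (A : E →L[ℝ] E) {MG ω₁ : ℝ} (hMG : 0 ≤ MG)
    (hflow : ∀ s : ℝ, 0 ≤ s → ∀ z : E, ‖exp (s • A) z‖ ≤ MG * Real.exp (ω₁ * s) * ‖z‖)
    (y : E) {lam ε : ℝ} (hε : 0 ≤ ε) {t T₀ : ℝ} (ht : t ∈ Icc 0 T₀) :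
    |‖exp (t • A) (ε • y)‖ - ε * Real.exp (lam * t)|
      ≤ ε * (MG * Real.exp ((|ω₁| + |lam|) * T₀) * T₀ * ‖A y - lam • y‖
          + Real.exp (|lam| * T₀) * |‖y‖ - 1|) := by
  have h1 := norm_linearFlow_sub_exp_smul_le A hMG hflow y lam ht
  have hexp0 : 0 < Real.exp (lam * t) := Real.exp_pos _
  have h2 : |‖exp (t • A) y‖ - Real.exp (lam * t)|
      ≤ ‖exp (t • A) y - Real.exp (lam * t) • y‖ + Real.exp (lam * t) * |‖y‖ - 1| := by
    have e2 : ‖Real.exp (lam * t) • y‖ = Real.exp (lam * t) * ‖y‖ := by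
      rw [norm_smul, Real.norm_of_nonneg hexp0.le]
    have e1 : |‖exp (t • A) y‖ - Real.exp (lam * t) * ‖y‖|
        ≤ ‖exp (t • A) y - Real.exp (lam * t) • y‖ := by
      have := abs_norm_sub_norm_le (exp (t • A) y) (Real.exp (lam * t) • y)
      rwa [e2] at this
    have e3 : |Real.exp (lam * t) * ‖y‖ - Real.exp (lam * t)|
        = Real.exp (lam * t) * |‖y‖ - 1| := by
      have : Real.exp (lam * t) * ‖y‖ - Real.exp (lam * t)
          = Real.exp (lam * t) * (‖y‖ - 1) := by ring
      rw [this, abs_mul, abs_of_pos hexp0]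
    calc |‖exp (t • A) y‖ - Real.exp (lam * t)|
        ≤ |‖exp (t • A) y‖ - Real.exp (lam * t) * ‖y‖|
          + |Real.exp (lam * t) * ‖y‖ - Real.exp (lam * t)| := abs_sub_le _ _ _
      _ = |‖exp (t • A) y‖ - Real.exp (lam * t) * ‖y‖| + Real.exp (lam * t) * |‖y‖ - 1| := by
          rw [e3]
      _ ≤ ‖exp (t • A) y - Real.exp (lam * t) • y‖ + Real.exp (lam * t) * |‖y‖ - 1| :=
          add_le_add e1 le_rfl
  have h3 : Real.exp (lam * t) ≤ Real.exp (|lam| * T₀) := Real.exp_le_exp.2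
    ((mul_le_mul_of_nonneg_right (le_abs_self _) ht.1).trans
      (mul_le_mul_of_nonneg_left ht.2 (abs_nonneg _)))
  have h4 : |‖exp (t • A) y‖ - Real.exp (lam * t)|
      ≤ MG * Real.exp ((|ω₁| + |lam|) * T₀) * T₀ * ‖A y - lam • y‖
          + Real.exp (|lam| * T₀) * |‖y‖ - 1| := by
    have := mul_le_mul_of_nonneg_right h3 (abs_nonneg (‖y‖ - 1))
    linarith
  rw [map_smul, norm_smul, Real.norm_of_nonneg hε, ← mul_sub, abs_mul, abs_of_nonneg hε]
  exact mul_le_mul_of_nonneg_left h4 hε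

end Consistency

/-! ### Closure of norm bounds under the `C⁰`-limit of Galerkin solutions -/

section Limit

variable {P : ℕ → E →L[ℝ] E} {F : E → E} {W Z : Set E} {T l : ℝ} {u : ℕ → E → ℝ → E}
  {φ : E → ℝ → E}

omit [NormedSpace ℝ E] in
/-- **Lower bounds pass to the uniform limit.** If the Galerkin solutions converge uniformly on
`Z × [0, T]` to `φ`, and for all large `n` the level-`n` solution from `x ∈ Z` obeys
`b n ≤ ‖u n x t‖` at a time `t ∈ [0, T]` with `b n → b₀`, then `b₀ ≤ ‖φ x t‖`. -/
theorem limit_norm_ge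
    (hφ : TendstoUniformlyOn (fun n (p : E × ℝ) => u n p.1 p.2) (fun p => φ p.1 p.2) atTop
      (Z ×ˢ Icc 0 T)) {x : E} (hx : x ∈ Z) {t : ℝ} (ht : t ∈ Icc 0 T) {b : ℕ → ℝ} {b₀ : ℝ}
    (hb : Tendsto b atTop (𝓝 b₀)) (hle : ∀ᶠ n in atTop, b n ≤ ‖u n x t‖) : b₀ ≤ ‖φ x t‖ := by
  have h1 : Tendsto (fun n => u n x t) atTop (𝓝 (φ x t)) :=
    hφ.tendsto_at (⟨hx, ht⟩ : (x, t) ∈ Z ×ˢ Icc 0 T)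
  exact le_of_tendsto_of_tendsto hb h1.norm hle

omit [NormedSpace ℝ E] in
/-- **Upper bounds pass to the uniform limit.** Dual of `limit_norm_ge`. -/
theorem limit_norm_le
    (hφ : TendstoUniformlyOn (fun n (p : E × ℝ) => u n p.1 p.2) (fun p => φ p.1 p.2) atTop
      (Z ×ˢ Icc 0 T)) {x : E} (hx : x ∈ Z) {t : ℝ} (ht : t ∈ Icc 0 T) {b : ℕ → ℝ} {b₀ : ℝ}
    (hb : Tendsto b atTop (𝓝 b₀)) (hle : ∀ᶠ n in atTop, ‖u n x t‖ ≤ b n) : ‖φ x t‖ ≤ b₀ := by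
  have h1 : Tendsto (fun n => u n x t) atTop (𝓝 (φ x t)) :=
    hφ.tendsto_at (⟨hx, ht⟩ : (x, t) ∈ Z ×ˢ Icc 0 T)
  exact le_of_tendsto_of_tendsto h1.norm hb hle

variable [CompleteSpace E]

/-- **Lower bounds for EVERY classical solution of the full system in `W`.** In a
`GalerkinConvergenceSetting P F W Z T l u` on a Banach space, let `w` be a classical solution of
`w' = F (w)` on `(0, T)`, continuous on `[0, T]`, with `w 0 = x ∈ Z`, staying in `W`. If for all
large `n` the Galerkin solutions from `x` obey `b n ≤ ‖u n x t‖` at `t ∈ [0, T]` with `b n → b₀`,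
then `b₀ ≤ ‖w t‖` (uniqueness within `W`: `w` is the uniform limit, `limit_unique`). -/
theorem solution_norm_ge (h : GalerkinConvergenceSetting P F W Z T l u) {x : E} (hx : x ∈ Z)
    {w : ℝ → E} (hw : ContinuousOn w (Icc 0 T)) (hw0 : w 0 = x)
    (hw' : ∀ t ∈ Ioo 0 T, HasDerivAt w (F (w t)) t) (hwW : ∀ t ∈ Icc 0 T, w t ∈ W)
    {t : ℝ} (ht : t ∈ Icc 0 T) {b : ℕ → ℝ} {b₀ : ℝ} (hb : Tendsto b atTop (𝓝 b₀))
    (hle : ∀ᶠ n in atTop, b n ≤ ‖u n x t‖) : b₀ ≤ ‖w t‖ := by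
  obtain ⟨φ, hφ⟩ := h.exists_tendstoUniformlyOn
  rw [h.limit_unique hφ hx hw hw0 hw' hwW ht]
  exact limit_norm_ge hφ hx ht hb hle

/-- **Upper bounds for EVERY classical solution of the full system in `W`.** Dual of
`solution_norm_ge`. -/
theorem solution_norm_le (h : GalerkinConvergenceSetting P F W Z T l u) {x : E} (hx : x ∈ Z)
    {w : ℝ → E} (hw : ContinuousOn w (Icc 0 T)) (hw0 : w 0 = x)
    (hw' : ∀ t ∈ Ioo 0 T, HasDerivAt w (F (w t)) t) (hwW : ∀ t ∈ Icc 0 T, w t ∈ W)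
    {t : ℝ} (ht : t ∈ Icc 0 T) {b : ℕ → ℝ} {b₀ : ℝ} (hb : Tendsto b atTop (𝓝 b₀))
    (hle : ∀ᶠ n in atTop, ‖u n x t‖ ≤ b n) : ‖w t‖ ≤ b₀ := by
  obtain ⟨φ, hφ⟩ := h.exists_tendstoUniformlyOn
  rw [h.limit_unique hφ hx hw hw0 hw' hwW ht]
  exact limit_norm_le hφ hx ht hb hle

/-- **The R-β floor for the TRUE trajectory from level floors.** If for all large `n` the Galerkin
solutions from `x` obey the level floor `a (1 − C_n Q² a) ≤ ‖u n x t‖` at `t ∈ [0, T]` (with the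
prediction value `a = ε e^{λt}`) and `C_n → C₀`, then every classical solution `w` of the full
system in `W` from `x` obeys `a (1 − C₀ Q² a) ≤ ‖w t‖`. -/
theorem floor_of_galerkin_levels (h : GalerkinConvergenceSetting P F W Z T l u) {x : E}
    (hx : x ∈ Z) {w : ℝ → E} (hw : ContinuousOn w (Icc 0 T)) (hw0 : w 0 = x)
    (hw' : ∀ t ∈ Ioo 0 T, HasDerivAt w (F (w t)) t) (hwW : ∀ t ∈ Icc 0 T, w t ∈ W)
    {t : ℝ} (ht : t ∈ Icc 0 T) {a Q C₀ : ℝ} {Cn : ℕ → ℝ} (hC : Tendsto Cn atTop (𝓝 C₀))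
    (hfloor : ∀ᶠ n in atTop, a * (1 - Cn n * Q ^ 2 * a) ≤ ‖u n x t‖) :
    a * (1 - C₀ * Q ^ 2 * a) ≤ ‖w t‖ := by
  have hb : Tendsto (fun n => a * (1 - Cn n * Q ^ 2 * a)) atTop
      (𝓝 (a * (1 - C₀ * Q ^ 2 * a))) :=
    (((hC.mul_const (Q ^ 2)).mul_const a).const_sub 1).const_mul a
  exact solution_norm_ge h hx hw hw0 hw' hwW ht hb hfloor

/-- **The decay bound for the TRUE trajectory from level bounds.** If for all large `n` the Galerkin
solutions from `x` obey `‖u n x t‖ ≤ 2 ε_n e^{λt}` at `t ∈ [0, T]` with `ε_n → ε`, then every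
classical solution `w` of the full system in `W` from `x` obeys `‖w t‖ ≤ 2 ε e^{λt}`. -/
theorem decay_of_galerkin_levels (h : GalerkinConvergenceSetting P F W Z T l u) {x : E}
    (hx : x ∈ Z) {w : ℝ → E} (hw : ContinuousOn w (Icc 0 T)) (hw0 : w 0 = x)
    (hw' : ∀ t ∈ Ioo 0 T, HasDerivAt w (F (w t)) t) (hwW : ∀ t ∈ Icc 0 T, w t ∈ W)
    {t : ℝ} (ht : t ∈ Icc 0 T) {lam ε : ℝ} {εn : ℕ → ℝ} (hε : Tendsto εn atTop (𝓝 ε))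
    (hdecay : ∀ᶠ n in atTop, ‖u n x t‖ ≤ 2 * (εn n * Real.exp (lam * t))) :
    ‖w t‖ ≤ 2 * (ε * Real.exp (lam * t)) := by
  exact solution_norm_le h hx hw hw0 hw' hwW ht ((hε.mul_const _).const_mul 2) hdecay

end Limit

end Summit.NavierStokesRegularity.FluidComputer.GalerkinEmergenceLimit

end
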